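import Summits.ABC.ABC.Theorems.RibetTakahashiSplitAbcValuationProductSubexp
import Literature.Barriers.ABC.BakerMethodBounds
import Literature.NumberTheory.DiophantineGeometry.AbcWave0SUnitProofs

/-!
# `AbcValuationProduct`: the regime `ω(abc) = 3` from Pasten's sub-exponential bound (2024)

The milestone `Summit.ABC.ABC.Theses.RibetTakahashiSplit.AbcValuationProduct` (stmt-ABC-1567,
`∏_{p ∣ abc} ν_p(abc) ≪_ε rad(abc)^ε`, OPEN) is `r2F ∧ SubexpPillai` by the sibling file
`…AbcValuationProductSubexp` (`abcValuationProduct_iff_manyPrimeFrey_and_subexpThreeFour`), where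
`SubexpPillai` is sub-exponential abc `log c ≤ κ_ε rad^ε` for the abc triples with
`ω(abc) ∈ {3, 4}`. This file removes the regime `ω(abc) = 3` — and the part of `ω(abc) = 4` with a
member equal to `1` or to a power of `2` — from that residual, CONDITIONALLY on one published
theorem: Pasten's sub-exponential bound

  `log c ≤ min{P(a), P(b), P(c)} · exp(κ √(log rad · log log rad))`

(H. Pasten, *The largest prime factor of `n² + 1` and improvements on subexponential `ABC`*,
Invent. Math. 236 (2024), Theorem 1.4 (2); in the tree the named fact
`Literature.Barriers.ABC.pasten2024_thm_1_4_2`, itself derived there from Evertse–Győry Thm 4.2.1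
over `ℚ` and Pasten's Theorem 2.5 by `pasten2024_thm_1_4_2_of`). `P` is the largest prime factor,
`P(1) = 1`.

* `AbcValuationProduct.exp_sqrt_log_mul_loglog_le` — `exp(κ √(log R log log R)) ≤ C_ε R^ε` for
  `R ≥ 1` (real analysis: `log L ≤ s²L + A_s`, `√(s²L² + A L) ≤ 2sL + A/(4s)`, `s = ε/(2κ+1)`).
* `AbcValuationProduct.min_largestPrimeFactor_le_two` — an abc triple with `ω(abc) ≤ 3` has a
  member with no odd prime factor (three members with odd prime factors give, with `2 ∣ abc`, four
  primes), so `min{P(a), P(b), P(c)} ≤ 2`.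
* `AbcValuationProduct.subexp_of_minLargestPrimeFactor_le_two` — Pasten's theorem gives
  `log c ≤ κ_ε rad^ε` on every abc triple with `min P ≤ 2` (radicals below Pasten's threshold `R₀`
  carry finitely many triples: Mahler's `S`-unit theorem, PROVED in the tree as
  `finite_setOf_isABCTriple_primeFactors_subset_holds`); hence on `ω(abc) ≤ 3`
  (`subexpThree_of_pasten`), hence the milestone itself holds on `ω(abc) ≤ 3`
  (`AbcValuationProduct.threeLe_of_pasten`, via `bddOmega_of_subexp`).
* `abcValuationProduct_iff_manyPrimeFrey_and_subexpFourOdd` — **modulo Pasten 2024 Thm 1.4 (2),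
  `AbcValuationProduct ⟺ r2F ∧ [log c ≪_ε rad^ε for the abc triples with ω(abc) = 4 and
  min{P(a),P(b),P(c)} ≥ 3]`**, i.e. for the single shape `{a, b, c} = {2^x p^y, q^z, r^w}`
  (`x, y, z, w ≥ 1`, `p, q, r` distinct odd primes; equations `2^x p^y ± q^z = ± r^w`), uniformly in
  the primes. On this shape Pasten's factor `min P = min(p, q, r) ≤ (rad/2)^{1/3}` only recovers
  Stewart–Yu; it is the exact Diophantine residue of the milestone's few-prime side.

References: H. Pasten, Invent. Math. 236 (2024), Thm 1.4; H. Pasten, *Shimura curves and the abc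
conjecture*, J. Number Theory 254 (2024), Conj. 1.14; K. Mahler, Math. Ann. 107 (1933).
-/

-- `Summit.<Summit>.<Problem>` is the mandated summit-side namespace (CONVENTIONS §2); for the
-- single-conjunct summit `ABC` the two coincide, so the duplicate `ABC.ABC` is deliberate.
set_option linter.dupNamespace false

noncomputable section

namespace Summit.ABC.ABC.Theorems

open Literature.NumberTheory.DiophantineGeometry Literature.Barriers.ABC
open Summit.ABC.ABC.Theses.RibetTakahashiSplit

/-! ### `exp(κ √(log R · log log R)) = R^{o(1)}` -/

/-- **Pasten's sub-exponential factor is `R^{o(1)}`.** For `κ ≥ 0` and `ε > 0` there is `C > 0`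
with `exp(κ √(log R · log log R)) ≤ C · R^ε` for all real `R ≥ 1` (where `√` of a negative number
is `0`). Proof: with `L = log R` and `s = ε/(2κ+1)`, `log L ≤ s² L − 1 − 2 log s ≤ s² L + A`
(`A = max(0, −1 − 2 log s)`), so `√(L log L) ≤ √(s²L² + AL) ≤ sL + √(AL) ≤ 2sL + A/(4s)` and
`κ √(L log L) ≤ ε L + κA/(4s)`. `[folklore]` -/
theorem AbcValuationProduct.exp_sqrt_log_mul_loglog_le {κ : ℝ} (hκ : 0 ≤ κ) {ε : ℝ} (hε : 0 < ε) :
    ∃ C : ℝ, 0 < C ∧ ∀ R : ℝ, 1 ≤ R →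
      Real.exp (κ * Real.sqrt (Real.log R * Real.log (Real.log R))) ≤ C * R ^ ε := by
  set s : ℝ := ε / (2 * κ + 1) with hs
  have hs0 : 0 < s := by positivity
  have h2κs : 2 * κ * s ≤ ε := by
    rw [hs, mul_div_assoc', div_le_iff₀ (by positivity)]
    nlinarith
  set A : ℝ := max 0 (-1 - 2 * Real.log s) with hA
  have hA0 : 0 ≤ A := le_max_left _ _
  refine ⟨Real.exp (κ * (A / (4 * s))), Real.exp_pos _, fun R hR => ?_⟩
  have hR0 : 0 < R := one_pos.trans_le hR
  set L : ℝ := Real.log R with hL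
  have hL0 : 0 ≤ L := Real.log_nonneg hR
  -- key: `κ √(L log L) ≤ ε L + κ A/(4s)`
  have key : κ * Real.sqrt (L * Real.log L) ≤ ε * L + κ * (A / (4 * s)) := by
    rcases le_or_gt (Real.log L) 0 with hlog | hlog
    · have h0 : Real.sqrt (L * Real.log L) = 0 :=
        Real.sqrt_eq_zero'.mpr (mul_nonpos_of_nonneg_of_nonpos hL0 hlog)
      rw [h0, mul_zero]
      positivity
    · have hLpos : 0 < L := by
        rcases hL0.eq_or_lt with h | h
        · rw [← h, Real.log_zero] at hlog; exact absurd hlog (lt_irrefl 0)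
        · exact h
      -- `log L ≤ s² L + A`
      have h1 : Real.log L ≤ s ^ 2 * L + A := by
        have h := Real.log_le_sub_one_of_pos (show 0 < s ^ 2 * L by positivity)
        rw [Real.log_mul (by positivity) hLpos.ne', Real.log_pow] at h
        have hA' : -1 - 2 * Real.log s ≤ A := le_max_right _ _
        push_cast at h
        linarith
      -- `L log L ≤ (sL)² + A L`
      have h2 : L * Real.log L ≤ (s * L) ^ 2 + A * L := by nlinarith
      -- `√(L log L) ≤ s L + √(A L)` and `√(A L) ≤ s L + A/(4s)`
      have h3 : Real.sqrt (L * Real.log L) ≤ s * L + Real.sqrt (A * L) := by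
        rw [Real.sqrt_le_iff]
        refine ⟨by positivity, h2.trans ?_⟩
        have hsq : Real.sqrt (A * L) ^ 2 = A * L := Real.sq_sqrt (by positivity)
        nlinarith [Real.sqrt_nonneg (A * L), hsq, mul_nonneg hs0.le hL0]
      have h4 : Real.sqrt (A * L) ≤ s * L + A / (4 * s) := by
        rw [Real.sqrt_le_iff]
        refine ⟨by positivity, ?_⟩
        have hid : (s * L + A / (4 * s)) ^ 2 = (s * L - A / (4 * s)) ^ 2 + A * L := by
          field_simp
          ring
        rw [hid]
        nlinarith [sq_nonneg (s * L - A / (4 * s))]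
      calc κ * Real.sqrt (L * Real.log L) ≤ κ * (2 * s * L + A / (4 * s)) := by
            apply mul_le_mul_of_nonneg_left _ hκ
            linarith
        _ = (2 * κ * s) * L + κ * (A / (4 * s)) := by ring
        _ ≤ ε * L + κ * (A / (4 * s)) := by
            have := mul_le_mul_of_nonneg_right h2κs hL0
            linarith
  calc Real.exp (κ * Real.sqrt (L * Real.log L)) ≤ Real.exp (ε * L + κ * (A / (4 * s))) :=
        Real.exp_le_exp.mpr key
    _ = Real.exp (κ * (A / (4 * s))) * Real.exp (ε * L) := by rw [Real.exp_add, mul_comm]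
    _ = Real.exp (κ * (A / (4 * s))) * R ^ ε := by
        rw [hL, Real.rpow_def_of_pos hR0, mul_comm (Real.log R) ε]

/-! ### `ω(abc) ≤ 3` forces a member with no odd prime factor -/

/-- If each member of an abc triple has an odd prime factor, then `ω(abc) ≥ 4`: the three odd
primes are pairwise distinct (the members are pairwise coprime) and `2 ∣ abc`. `[folklore]` -/
theorem AbcValuationProduct.four_le_card_primeFactors_of_odd_primeFactors {a b c : ℕ}
    (h : IsABCTriple a b c) {p q r : ℕ} (hp : p ∈ a.primeFactors) (hq : q ∈ b.primeFactors)
    (hr : r ∈ c.primeFactors) (hp2 : p ≠ 2) (hq2 : q ≠ 2) (hr2 : r ≠ 2) :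
    4 ≤ (a * b * c).primeFactors.card := by
  have h0 : a * b * c ≠ 0 := h.mul_ne_zero
  obtain ⟨-, -, habc, hcop⟩ := id h
  have hac : Nat.Coprime a c := by rw [← habc]; exact Nat.coprime_self_add_right.2 hcop
  have hbc : Nat.Coprime b c := by rw [← habc]; exact Nat.coprime_add_self_right.2 hcop.symm
  have hpP := Nat.prime_of_mem_primeFactors hp
  have hqP := Nat.prime_of_mem_primeFactors hq
  have hpa := Nat.dvd_of_mem_primeFactors hp
  have hqb := Nat.dvd_of_mem_primeFactors hq
  have hrc := Nat.dvd_of_mem_primeFactors hr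
  -- the three odd primes are pairwise distinct
  have hpq : p ≠ q := fun he => hpP.one_lt.ne'
    (Nat.Coprime.eq_one_of_dvd (Nat.Coprime.coprime_dvd_left hpa hcop) (he ▸ hqb))
  have hpr : p ≠ r := fun he => hpP.one_lt.ne'
    (Nat.Coprime.eq_one_of_dvd (Nat.Coprime.coprime_dvd_left hpa hac) (he ▸ hrc))
  have hqr : q ≠ r := fun he => hqP.one_lt.ne'
    (Nat.Coprime.eq_one_of_dvd (Nat.Coprime.coprime_dvd_left hqb hbc) (he ▸ hrc))
  have hsub : ({2, p, q, r} : Finset ℕ) ⊆ (a * b * c).primeFactors := by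
    intro x hx
    simp only [Finset.mem_insert, Finset.mem_singleton] at hx
    rcases hx with rfl | rfl | rfl | rfl
    · exact AbcValuationProduct.two_mem_primeFactors h
    · exact Nat.primeFactors_mono (dvd_mul_of_dvd_left (dvd_mul_right a b) c) h0 hp
    · exact Nat.primeFactors_mono (dvd_mul_of_dvd_left (dvd_mul_left b a) c) h0 hq
    · exact Nat.primeFactors_mono (dvd_mul_left c (a * b)) h0 hr
  have hcard : ({2, p, q, r} : Finset ℕ).card = 4 := by
    rw [Finset.card_insert_of_notMem (by simp [Ne.symm hp2, Ne.symm hq2, Ne.symm hr2]),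
      Finset.card_insert_of_notMem (by simp [hpq, hpr]), Finset.card_pair hqr]
  exact hcard ▸ Finset.card_le_card hsub

/-- If `P(m) ≥ 3` then `m` has an odd prime factor (`P(m) = max(1, max primeFactors(m))`).
`[folklore]` -/
theorem AbcValuationProduct.exists_odd_primeFactor_of_three_le_largestPrimeFactor {m : ℕ}
    (h : 3 ≤ largestPrimeFactor m) : ∃ p ∈ m.primeFactors, p ≠ 2 := by
  rw [largestPrimeFactor_def] at h
  have hne : m.primeFactors.Nonempty := by
    by_contra hne
    rw [Finset.not_nonempty_iff_eq_empty] at hne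
    rw [hne, Finset.sup_empty] at h
    simp at h
  obtain ⟨p, hp, hsup⟩ := Finset.exists_mem_eq_sup _ hne id
  refine ⟨p, hp, ?_⟩
  rw [hsup, id] at h
  omega

/-- **`ω(abc) ≤ 3 ⟹ min{P(a), P(b), P(c)} ≤ 2`.** An abc triple whose product has at most three
prime factors has a member without odd prime factors, i.e. equal to `1` or to a power of `2` (up to
order: `1 + 1 = 2`, `1 + q^s = r^t`, `{2^x, p^y, q^z}`, `(1, 2^x p^y, q^z)`-type). `[folklore]` -/
theorem AbcValuationProduct.min_largestPrimeFactor_le_two {a b c : ℕ} (h : IsABCTriple a b c)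
    (h3 : (a * b * c).primeFactors.card ≤ 3) :
    min (largestPrimeFactor a) (min (largestPrimeFactor b) (largestPrimeFactor c)) ≤ 2 := by
  by_contra hmin
  push Not at hmin
  obtain ⟨ha, hbc⟩ := lt_min_iff.mp hmin
  obtain ⟨hb, hc⟩ := lt_min_iff.mp hbc
  obtain ⟨p, hp, hp2⟩ :=
    AbcValuationProduct.exists_odd_primeFactor_of_three_le_largestPrimeFactor (by omega : 3 ≤ _)
      (m := a)
  obtain ⟨q, hq, hq2⟩ :=
    AbcValuationProduct.exists_odd_primeFactor_of_three_le_largestPrimeFactor (by omega : 3 ≤ _)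
      (m := b)
  obtain ⟨r, hr, hr2⟩ :=
    AbcValuationProduct.exists_odd_primeFactor_of_three_le_largestPrimeFactor (by omega : 3 ≤ _)
      (m := c)
  have := AbcValuationProduct.four_le_card_primeFactors_of_odd_primeFactors h hp hq hr hp2 hq2 hr2
  omega

/-! ### Sub-exponential abc when some member is `1` or a power of `2` (Pasten 2024) -/

/-- **Pasten 2024, Thm 1.4 (2) ⟹ `log c ≪_ε rad^ε` whenever `min{P(a), P(b), P(c)} ≤ 2`**, i.e.
whenever some member of the abc triple is `1` or a power of `2`: for `rad ≥ R₀` Pasten's bound reads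
`log c ≤ 2 exp(κ √(log rad · log log rad)) ≤ 2 C_ε rad^ε`; the triples with `rad < R₀` have all
prime factors `< ⌈R₀⌉` and are finitely many (Mahler's `S`-unit theorem,
`finite_setOf_isABCTriple_primeFactors_subset_holds`, proved in the tree), so their `log c` is
bounded. [cite: Pasten2024, Theorem 1.4 (2)] -/
theorem AbcValuationProduct.subexp_of_minLargestPrimeFactor_le_two (hP : pasten2024_thm_1_4_2) :
    ∀ ε : ℝ, 0 < ε → ∃ κ : ℝ, ∀ a b c : ℕ, IsABCTriple a b c →
      min (largestPrimeFactor a) (min (largestPrimeFactor b) (largestPrimeFactor c)) ≤ 2 →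
      Real.log c ≤ κ * (rad a b c : ℝ) ^ ε := by
  intro ε hε
  obtain ⟨κ₀, hκ₀, R₀, hR₀⟩ := hP
  obtain ⟨C, hC, hexp⟩ := AbcValuationProduct.exp_sqrt_log_mul_loglog_le hκ₀.le hε
  -- the finitely many triples of small radical
  have hF := finite_setOf_isABCTriple_primeFactors_subset_holds (Finset.range ⌈R₀⌉₊)
  obtain ⟨M, hM⟩ := (hF.image fun t : ℕ × ℕ × ℕ => Real.log (t.2.2 : ℝ)).bddAbove
  refine ⟨max (2 * C) (max M 0), fun a b c ht hmin => ?_⟩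
  have hR : (0 : ℝ) < (rad a b c : ℝ) := cast_rad_pos a b c
  have hR1 : (1 : ℝ) ≤ (rad a b c : ℝ) := by
    exact_mod_cast (le_trans (by norm_num) ht.two_le_rad : 1 ≤ rad a b c)
  have hRε : 1 ≤ (rad a b c : ℝ) ^ ε := Real.one_le_rpow hR1 hε.le
  have hK0 : 0 ≤ max (2 * C) (max M 0) := le_max_of_le_right (le_max_right _ _)
  by_cases hsmall : (rad a b c : ℝ) < R₀
  · -- small radical: the triple lies in the finite set
    have hmem : (⟨a, b, c⟩ : ℕ × ℕ × ℕ) ∈ {t : ℕ × ℕ × ℕ | IsABCTriple t.1 t.2.1 t.2.2 ∧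
        (t.1 * t.2.1 * t.2.2).primeFactors ⊆ Finset.range ⌈R₀⌉₊} := by
      refine ⟨ht, fun p hp => Finset.mem_range.mpr ?_⟩
      dsimp only at hp
      have hp' : p ∈ (UniqueFactorizationMonoid.radical (a * b * c)).primeFactors := by
        rwa [Nat.primeFactors_radical]
      have hprad : p ∣ rad a b c := by
        rw [rad_def]; exact Nat.dvd_of_mem_primeFactors hp'
      have hple : p ≤ rad a b c :=
        Nat.le_of_dvd (by rw [rad_def]; exact Nat.radical_pos _) hprad
      have hplt : (p : ℝ) < ⌈R₀⌉₊ :=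
        calc (p : ℝ) ≤ rad a b c := by exact_mod_cast hple
          _ < R₀ := hsmall
          _ ≤ ⌈R₀⌉₊ := Nat.le_ceil R₀
      exact_mod_cast hplt
    have hlogc : Real.log c ≤ M := hM ⟨(⟨a, b, c⟩ : ℕ × ℕ × ℕ), hmem, rfl⟩
    calc Real.log c ≤ M := hlogc
      _ ≤ max (2 * C) (max M 0) := (le_max_left _ _).trans (le_max_right _ _)
      _ ≤ max (2 * C) (max M 0) * (rad a b c : ℝ) ^ ε := le_mul_of_one_le_right hK0 hRε
  · -- large radical: Pasten's bound with `min P ≤ 2` and `exp(κ₀ √(…)) ≤ C rad^ε`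
    push Not at hsmall
    have h1 := hR₀ a b c ht hsmall
    have hq : ((min (largestPrimeFactor a) (min (largestPrimeFactor b) (largestPrimeFactor c)) :
        ℕ) : ℝ) ≤ 2 := by exact_mod_cast hmin
    have h2 := hexp (rad a b c : ℝ) hR1
    have hE : 0 ≤ Real.exp (κ₀ * Real.sqrt (Real.log (rad a b c : ℕ) *
        Real.log (Real.log (rad a b c : ℕ)))) := (Real.exp_pos _).le
    calc Real.log c ≤ _ := h1
      _ ≤ 2 * Real.exp (κ₀ * Real.sqrt (Real.log (rad a b c : ℕ) *
            Real.log (Real.log (rad a b c : ℕ)))) := mul_le_mul_of_nonneg_right hq hE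
      _ ≤ 2 * (C * (rad a b c : ℝ) ^ ε) := by linarith
      _ = (2 * C) * (rad a b c : ℝ) ^ ε := by ring
      _ ≤ max (2 * C) (max M 0) * (rad a b c : ℝ) ^ ε :=
          mul_le_mul_of_nonneg_right (le_max_left _ _) (by positivity)

/-- **Pasten 2024, Thm 1.4 (2) ⟹ sub-exponential abc on `ω(abc) ≤ 3`**: `log c ≤ κ_ε rad(abc)^ε`
for every abc triple whose product has at most three prime factors (`min P ≤ 2` there, by
`AbcValuationProduct.min_largestPrimeFactor_le_two`). [cite: Pasten2024, Theorem 1.4 (2)] -/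
theorem AbcValuationProduct.subexpThree_of_pasten (hP : pasten2024_thm_1_4_2) :
    ∀ ε : ℝ, 0 < ε → ∃ κ : ℝ, ∀ a b c : ℕ, IsABCTriple a b c →
      (a * b * c).primeFactors.card ≤ 3 → Real.log c ≤ κ * (rad a b c : ℝ) ^ ε := by
  intro ε hε
  obtain ⟨κ, hκ⟩ := AbcValuationProduct.subexp_of_minLargestPrimeFactor_le_two hP ε hε
  exact ⟨κ, fun a b c ht h3 =>
    hκ a b c ht (AbcValuationProduct.min_largestPrimeFactor_le_two ht h3)⟩

/-- **Pasten 2024, Thm 1.4 (2) ⟹ the milestone on `ω(abc) ≤ 3`**: `∏ ν_p(abc) ≤ K_ε rad(abc)^ε`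
for every abc triple with `ω(abc) ≤ 3` — the regime `{2, p, q}` of the Pillai equations
`2^x ± p^y = ± q^z`, `1 + 2^x p^y = q^z`, … is thereby removed from the open residual of
`AbcValuationProduct` (bounded `ω`: `AbcValuationProduct.bddOmega_of_subexp`).
[cite: Pasten2024, Theorem 1.4 (2)] -/
theorem AbcValuationProduct.threeLe_of_pasten (hP : pasten2024_thm_1_4_2) :
    ∀ ε : ℝ, 0 < ε → ∃ K : ℝ, ∀ a b c : ℕ, IsABCTriple a b c →
      (a * b * c).primeFactors.card ≤ 3 →
      (exponentProduct (a * b * c) : ℝ) ≤ K * (rad a b c : ℝ) ^ ε :=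
  AbcValuationProduct.bddOmega_of_subexp 3 (AbcValuationProduct.subexpThree_of_pasten hP)

/-! ### The residual of the milestone modulo r2F and Pasten: one shape with `ω(abc) = 4` -/

/-- **Modulo Pasten 2024 Thm 1.4 (2): `AbcValuationProduct ⟺ r2F ∧ SubexpFourOdd`.** Assuming
`pasten2024_thm_1_4_2`, the milestone (stmt-ABC-1567) is equivalent to the conjunction of the
many-prime crux on the Frey–Hellegouarch class `ManyPrimeValuationProductFrey` (stmt-ABC-15149) and
sub-exponential abc `log c ≤ κ_ε rad(abc)^ε` for the abc triples with `ω(abc) = 4` and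
`min{P(a), P(b), P(c)} ≥ 3` — every member has an odd prime factor, so up to order
`{a, b, c} = {2^x p^y, q^z, r^w}` with `x, y, z, w ≥ 1` and `p, q, r` distinct odd primes
(`2^x p^y ± q^z = ± r^w`), the bound being uniform in `p, q, r`. "⟹" is
`abcValuationProduct_iff_manyPrimeFrey_and_subexpThreeFour`; "⟸" splits a triple with
`ω(abc) ∈ {3, 4}` by `min P ≤ 2` (Pasten, `subexp_of_minLargestPrimeFactor_le_two`) or `min P ≥ 3`
(then `ω(abc) = 4` by `min_largestPrimeFactor_le_two`). [cite: Pasten2024, Theorem 1.4 (2)] -/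
theorem abcValuationProduct_iff_manyPrimeFrey_and_subexpFourOdd (hP : pasten2024_thm_1_4_2) :
    AbcValuationProduct ↔
      (ManyPrimeValuationProductFrey ∧
        ∀ ε : ℝ, 0 < ε → ∃ κ : ℝ, ∀ a b c : ℕ, IsABCTriple a b c →
          (a * b * c).primeFactors.card = 4 →
          3 ≤ min (largestPrimeFactor a) (min (largestPrimeFactor b) (largestPrimeFactor c)) →
          Real.log c ≤ κ * (rad a b c : ℝ) ^ ε) := by
  rw [abcValuationProduct_iff_manyPrimeFrey_and_subexpThreeFour]
  refine and_congr_right' ⟨fun h ε hε => ?_, fun h ε hε => ?_⟩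
  · obtain ⟨κ, hκ⟩ := h ε hε
    exact ⟨κ, fun a b c ht h4 _ => hκ a b c ht (by omega) (by omega)⟩
  · obtain ⟨κ₁, hκ₁⟩ := AbcValuationProduct.subexp_of_minLargestPrimeFactor_le_two hP ε hε
    obtain ⟨κ₂, hκ₂⟩ := h ε hε
    refine ⟨max κ₁ κ₂, fun a b c ht h3 h4 => ?_⟩
    have hR : (0 : ℝ) < (rad a b c : ℝ) := cast_rad_pos a b c
    have hRε : 0 ≤ (rad a b c : ℝ) ^ ε := Real.rpow_nonneg hR.le _
    rcases le_or_gt (min (largestPrimeFactor a)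
        (min (largestPrimeFactor b) (largestPrimeFactor c))) 2 with hmin | hmin
    · exact (hκ₁ a b c ht hmin).trans (mul_le_mul_of_nonneg_right (le_max_left _ _) hRε)
    · have hω : (a * b * c).primeFactors.card = 4 := by
        rcases h4.lt_or_eq with hlt | heq
        · exact absurd (AbcValuationProduct.min_largestPrimeFactor_le_two ht (by omega))
            (by omega)
        · exact heq
      exact (hκ₂ a b c ht hω (by omega)).trans
        (mul_le_mul_of_nonneg_right (le_max_right _ _) hRε)

/-- **Modulo r2F and Pasten 2024 Thm 1.4 (2), the milestone is `SubexpFourOdd`.** Given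
`ManyPrimeValuationProductFrey` and `pasten2024_thm_1_4_2`, `AbcValuationProduct` holds iff
`log c ≤ κ_ε rad(abc)^ε` for the abc triples `{2^x p^y, q^z, r^w}` (`ω(abc) = 4`, every member
with an odd prime factor). [cite: Pasten2024, Theorem 1.4 (2)] -/
theorem abcValuationProduct_iff_subexpFourOdd_of_manyPrimeValuationProductFrey
    (hP : pasten2024_thm_1_4_2) (h₂ : ManyPrimeValuationProductFrey) :
    AbcValuationProduct ↔
      ∀ ε : ℝ, 0 < ε → ∃ κ : ℝ, ∀ a b c : ℕ, IsABCTriple a b c →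
        (a * b * c).primeFactors.card = 4 →
        3 ≤ min (largestPrimeFactor a) (min (largestPrimeFactor b) (largestPrimeFactor c)) →
        Real.log c ≤ κ * (rad a b c : ℝ) ^ ε := by
  rw [abcValuationProduct_iff_manyPrimeFrey_and_subexpFourOdd hP]
  exact ⟨fun h => h.2, fun h => ⟨h₂, h⟩⟩

end Summit.ABC.ABC.Theorems

end
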